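import Summits.HodgeConjecture.CorCM.RationalExteriorAlgebra
import Literature.AlgebraicGeometry.HodgeTheory.BettiUniverseAxioms
import Literature.AlgebraicGeometry.HodgeTheory.AbelianVarietyEndomorphismsHOne
import Mathlib.LinearAlgebra.ExteriorPower.Pairing
import Mathlib.NumberTheory.NumberField.CMField
import HarnessLib

/-!
# COR-CM model layer, row M22 input R2 (part B, algebra): the Rosati identity in BETTI DUAL FORM from
# the `K`-balanced identity on `H²`

Cell `pub-hodgecm2` (COR-CM = Hodge ladder stage 2), binder row M22 `Fact_algDuality`, input **R2** (a polarisation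
class whose Rosati involution induces complex conjugation on the CM field), seat b26.  HONEST FRAMING: pure linear
algebra on the tree's rational Betti carriers; nothing about algebraic cycles and no case of the Hodge conjecture.

What the kernel K-a of row M22 (model-1, INBOX 2026-08-20T18:52:18Z) consumes from R2 is the ROSATI IDENTITY IN
BETTI DUAL FORM: for the alternating form `B_θ` on the dual of `H¹(A(ℂ); ℚ)` attached to a class `θ ∈ H²(A(ℂ); ℚ)
= ⋀² H¹(A(ℂ); ℚ)` (`hasExteriorCohomologyH1_rat`) and the rational CM action `ι : K → End_ℚ H¹(A(ℂ); ℚ)`,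

  `B_θ(φ ∘ ι(a), ψ) = B_θ(φ, ψ ∘ ι(ā))`  for all `a ∈ K`, `φ, ψ ∈ H¹(A(ℂ); ℚ)ᵛ`

(Deligne, LNM 900 §4 p. 47: "the Rosati involution defined by `θ` induces complex conjugation on `E` … determined by
`ψ(ev, w) = ψ(v, e†w)`"; Shimura 1998 §6.2 Thm. 4: `E(z, T(ξ)w) = E(T(ξ^ρ)z, w)`).  Here
`B_θ(φ, ψ) := exteriorPower.alternatingMapToDual ℚ H¹ 2 ![φ, ψ] ((wedgeToCup)⁻¹ θ)` (Mathlib's canonical pairing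
`⋀²(Vᵛ) × ⋀²V → ℚ`; on a pure wedge `B_{x∧y}(φ, ψ) = φ(x)ψ(y) - ψ(x)φ(y)`), stated INLINE (this file declares no
definition).

What the averaging construction of the polarisation class (van Geemen, LNM 1594 Lemma 5.2 (1); the tree's
`Deligne1982.WeilTypeCMRosatiPolarization` §4 "`D Π = 0`") natively yields is the **`K`-balanced identity on `H²`**:
for every purely imaginary algebraic integer `b ∈ 𝓞_K` (`b̄ = -b`) acting through an endomorphism `u_b` of `A`,
`(𝟙 + u_b)^* θ = θ + u_b^* θ` in `H²(A(ℂ); ℚ)`.  This file proves, by pure linear algebra, that the `K`-balanced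
identity implies the dual-form Rosati identity for EVERY `a ∈ K`:

* §1 `IsCMField.forall_of_forall_imaginary` — in a CM field a property of elements that is additive,
  multiplicative and holds on the purely imaginary elements holds everywhere (`a = (a+ā)/2 + (a-ā)/2` and the real
  part is `(rη)·η⁻¹` with `η, rη, η⁻¹` purely imaginary, `η = x - x̄ ≠ 0`);
* §2 the dual pairing on `⋀²V`: value on pure wedges, NATURALITY `B_{⋀²g ω}(φ, ψ) = B_ω(φ∘g, ψ∘g)`, and the
  DERIVATION IDENTITY `⋀²(1+f) ω = ω + ⋀²f ω ⟹ B_ω(φ∘f, ψ) + B_ω(φ, ψ∘f) = 0`;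
* §3 `altDual_rosati_of_balanced` — over an abstract `ℚ`-algebra action `ι : K →ₐ[ℚ] End_ℚ V`: the derivation
  identity for the purely imaginary INTEGERS implies `B_ω(φ∘ι a, ψ) = B_ω(φ, ψ∘ι ā)` for all `a ∈ K` (the set of
  such `a` is closed under `+` and `*`; integer multiples reach all imaginary elements of `K`);
* §4 `bettiDual_rosati_of_balanced` — the Betti specialisation: `V = H¹(A(ℂ); ℚ)` of a complex abelian variety,
  `ω = (wedgeToCup)⁻¹ θ`, the `K`-balanced identity read on `H²` along morphisms `F_b, G_b : A → A` with
  `G_b^* = 1 + F_b^*` and `F_b^* = ι(b)` on `H¹` (naturality `map_wedgeToCup` of the comparison isomorphism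
  `⋀² H¹ ≅ H²`, `hasExteriorCohomologyH1_rat`).

## References
* [Deligne1982HodgeCycles] P. Deligne (notes by J. S. Milne), *Hodge cycles on abelian varieties*, LNM 900 (1982),
  §4 p. 47, §5 Prop. 5.1.
* [Shimura1998] G. Shimura, *Abelian Varieties with Complex Multiplication and Modular Functions* (1998), §6.2 Thm. 4.
* [vanGeemen1994HodgeAV] B. van Geemen, *An introduction to the Hodge conjecture for abelian varieties*, LNM 1594
  (1994), Lemma 5.2 (1).
* [LangeBirkenhake1992] H. Lange, Ch. Birkenhake, *Complex Abelian Varieties* (1992), §5.1 (Rosati involution),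
  Lemma 1.1.17.
-/

noncomputable section

open CategoryTheory
open Literature.AlgebraicTopology.SingularHomology
open Literature.AlgebraicGeometry Literature.AlgebraicGeometry.Motives Literature.AlgebraicGeometry.HodgeTheory
open NumberField

namespace Summit.HodgeConjecture.CorCM.Model

/-! ### §1 CM fields: additive, multiplicative properties of the purely imaginary elements hold everywhere -/

section CMField

variable {K : Type*} [Field K] [NumberField K] [IsCMField K]

/-- A CM field has a non-zero purely imaginary element (`η = x - x̄` for any `x` moved by complex conjugation,
which is not the identity). [cite: LangeBirkenhake1992, §5.1] -/
theorem IsCMField.exists_imaginary_ne_zero :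
    ∃ η : K, η ≠ 0 ∧ IsCMField.complexConj K η = -η := by
  obtain ⟨x, hx⟩ : ∃ x : K, IsCMField.complexConj K x ≠ x := by
    by_contra h
    push Not at h
    exact IsCMField.complexConj_ne_one K (AlgEquiv.ext h)
  refine ⟨x - IsCMField.complexConj K x, sub_ne_zero.2 (Ne.symm hx), ?_⟩
  rw [map_sub, IsCMField.complexConj_apply_apply, neg_sub]

/-- **Induction on a CM field from its purely imaginary elements**: a property of elements of a CM field `K`
which is stable under addition and multiplication and holds for every purely imaginary element (`b̄ = -b`) holds
for every element: `a = r + s` with `s = (a - ā)/2` imaginary and `r = (a + ā)/2 = (rη)·η⁻¹` a product of two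
imaginary elements, `η ≠ 0` imaginary. [cite: LangeBirkenhake1992, §5.1] -/
theorem IsCMField.forall_of_forall_imaginary {P : K → Prop}
    (hadd : ∀ a b, P a → P b → P (a + b)) (hmul : ∀ a b, P a → P b → P (a * b))
    (him : ∀ b, IsCMField.complexConj K b = -b → P b) (a : K) : P a := by
  obtain ⟨η, hη0, hη⟩ := IsCMField.exists_imaginary_ne_zero (K := K)
  have h2 : IsCMField.complexConj K (2⁻¹ : K) = 2⁻¹ := by rw [map_inv₀, map_ofNat]
  have hrs : a = 2⁻¹ * (a + IsCMField.complexConj K a) + 2⁻¹ * (a - IsCMField.complexConj K a) := by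
    rw [← mul_add, add_add_sub_cancel, ← two_mul, ← mul_assoc, inv_mul_cancel₀ two_ne_zero, one_mul]
  have hcr : IsCMField.complexConj K (2⁻¹ * (a + IsCMField.complexConj K a)) =
      2⁻¹ * (a + IsCMField.complexConj K a) := by
    rw [map_mul, h2, map_add, IsCMField.complexConj_apply_apply, add_comm]
  have hcs : IsCMField.complexConj K (2⁻¹ * (a - IsCMField.complexConj K a)) =
      -(2⁻¹ * (a - IsCMField.complexConj K a)) := by
    rw [map_mul, h2, map_sub, IsCMField.complexConj_apply_apply, ← neg_sub, mul_neg]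
  have hηi : IsCMField.complexConj K η⁻¹ = -η⁻¹ := by rw [map_inv₀, hη, inv_neg]
  have hrη : IsCMField.complexConj K (2⁻¹ * (a + IsCMField.complexConj K a) * η) =
      -(2⁻¹ * (a + IsCMField.complexConj K a) * η) := by
    rw [map_mul, hcr, hη, mul_neg]
  have hPr : P (2⁻¹ * (a + IsCMField.complexConj K a)) := by
    have h := hmul _ _ (him _ hrη) (him _ hηi)
    rwa [mul_assoc, mul_inv_cancel₀ hη0, mul_one] at h
  rw [hrs]
  exact hadd _ _ hPr (him _ hcs)

/-- Every purely imaginary element of a number field `K` with an involution is a rational multiple of a purely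
imaginary ALGEBRAIC INTEGER: `m • b ∈ 𝓞_K` for some `m ∈ ℕ`, `m ≠ 0`, and `m • b` is still imaginary.
[cite: LangeBirkenhake1992, §5.1] -/
theorem IsCMField.exists_nsmul_mem_ringOfIntegers_imaginary (b : K) (hb : IsCMField.complexConj K b = -b) :
    ∃ (m : ℕ) (s : 𝓞 K), m ≠ 0 ∧ (m : ℚ) • b = (s : K) ∧ IsCMField.complexConj K (s : K) = -(s : K) := by
  have hx : IsAlgebraic ℤ b := (IsFractionRing.isAlgebraic_iff ℤ ℚ K).mpr (.of_finite ℚ b)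
  obtain ⟨m, s, hm, hs⟩ := hx.exists_nsmul_eq (𝓞 K)
  refine ⟨m, s, hm, ?_, ?_⟩
  · rw [Nat.cast_smul_eq_nsmul]
    exact hs
  · have hs' : (s : K) = m • b := hs.symm
    rw [hs', map_nsmul, hb, smul_neg]

end CMField

/-! ### §2 The dual pairing on the exterior square -/

section Wedge

variable {F : Type*} [Field F] {V : Type*} [AddCommGroup V] [Module F V]

/-- The dual pairing on a pure wedge: `B_{v₀ ∧ v₁}(φ, ψ) = φ(v₀)ψ(v₁) - ψ(v₀)φ(v₁)` (the `2 × 2` determinant).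
[cite: LangeBirkenhake1992, Lemma 1.1.17] -/
theorem altDual_two_ιMulti (φ ψ : Module.Dual F V) (v : Fin 2 → V) :
    exteriorPower.alternatingMapToDual F V 2 ![φ, ψ] (exteriorPower.ιMulti F 2 v) =
      φ (v 0) * ψ (v 1) - ψ (v 0) * φ (v 1) := by
  rw [exteriorPower.alternatingMapToDual_apply_ιMulti, Matrix.det_fin_two]
  simp only [Matrix.of_apply, Matrix.cons_val_zero, Matrix.cons_val_one]

/-- Two linear functionals on `⋀²V` agree as soon as they agree on pure wedges. [folklore] -/
theorem dual_exteriorPower_two_ext {D₁ D₂ : Module.Dual F (⋀[F]^2 V)}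
    (h : ∀ v : Fin 2 → V, D₁ (exteriorPower.ιMulti F 2 v) = D₂ (exteriorPower.ιMulti F 2 v)) : D₁ = D₂ :=
  exteriorPower.linearMap_ext (by ext v; exact h v)

/-- The dual pairing is additive in the first covector. [folklore] -/
theorem altDual_two_add_left (φ φ' ψ : Module.Dual F V) (ω : ⋀[F]^2 V) :
    exteriorPower.alternatingMapToDual F V 2 ![φ + φ', ψ] ω =
      exteriorPower.alternatingMapToDual F V 2 ![φ, ψ] ω +
        exteriorPower.alternatingMapToDual F V 2 ![φ', ψ] ω := by
  rw [← LinearMap.add_apply]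
  congr 1
  exact dual_exteriorPower_two_ext fun v ↦ by
    simp only [LinearMap.add_apply, altDual_two_ιMulti]; ring

/-- The dual pairing is additive in the second covector. [folklore] -/
theorem altDual_two_add_right (φ ψ ψ' : Module.Dual F V) (ω : ⋀[F]^2 V) :
    exteriorPower.alternatingMapToDual F V 2 ![φ, ψ + ψ'] ω =
      exteriorPower.alternatingMapToDual F V 2 ![φ, ψ] ω +
        exteriorPower.alternatingMapToDual F V 2 ![φ, ψ'] ω := by
  rw [← LinearMap.add_apply]
  congr 1
  exact dual_exteriorPower_two_ext fun v ↦ by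
    simp only [LinearMap.add_apply, altDual_two_ιMulti]; ring

/-- The dual pairing is homogeneous in the first covector. [folklore] -/
theorem altDual_two_smul_left (c : F) (φ ψ : Module.Dual F V) (ω : ⋀[F]^2 V) :
    exteriorPower.alternatingMapToDual F V 2 ![c • φ, ψ] ω =
      c * exteriorPower.alternatingMapToDual F V 2 ![φ, ψ] ω := by
  rw [← smul_eq_mul, ← LinearMap.smul_apply]
  congr 1
  exact dual_exteriorPower_two_ext fun v ↦ by
    simp only [LinearMap.smul_apply, altDual_two_ιMulti, smul_eq_mul]; ring

/-- The dual pairing is homogeneous in the second covector. [folklore] -/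
theorem altDual_two_smul_right (c : F) (φ ψ : Module.Dual F V) (ω : ⋀[F]^2 V) :
    exteriorPower.alternatingMapToDual F V 2 ![φ, c • ψ] ω =
      c * exteriorPower.alternatingMapToDual F V 2 ![φ, ψ] ω := by
  rw [← smul_eq_mul, ← LinearMap.smul_apply]
  congr 1
  exact dual_exteriorPower_two_ext fun v ↦ by
    simp only [LinearMap.smul_apply, altDual_two_ιMulti, smul_eq_mul]; ring

/-- The dual pairing is negated in the second covector under `ψ ↦ -ψ`. [folklore] -/
theorem altDual_two_neg_right (φ ψ : Module.Dual F V) (ω : ⋀[F]^2 V) :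
    exteriorPower.alternatingMapToDual F V 2 ![φ, -ψ] ω =
      -exteriorPower.alternatingMapToDual F V 2 ![φ, ψ] ω := by
  rw [← neg_one_smul F ψ, altDual_two_smul_right, neg_one_mul]

/-- **Naturality of the dual pairing** under the functoriality of `⋀²`: `B_{⋀²g ω}(φ, ψ) = B_ω(φ ∘ g, ψ ∘ g)`.
[folklore] -/
theorem altDual_two_map (φ ψ : Module.Dual F V) (g : V →ₗ[F] V) (ω : ⋀[F]^2 V) :
    exteriorPower.alternatingMapToDual F V 2 ![φ, ψ] (exteriorPower.map 2 g ω) =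
      exteriorPower.alternatingMapToDual F V 2 ![φ ∘ₗ g, ψ ∘ₗ g] ω := by
  rw [← LinearMap.comp_apply]
  congr 1
  exact dual_exteriorPower_two_ext fun v ↦ by
    simp only [LinearMap.coe_comp, Function.comp_apply, exteriorPower.map_apply_ιMulti, altDual_two_ιMulti]

/-- **The derivation identity**: if `⋀²(1 + f) ω = ω + ⋀²f ω` (the mixed term `(f ⊗ 1 + 1 ⊗ f) ω` of the
expansion vanishes), then `B_ω(φ ∘ f, ψ) + B_ω(φ, ψ ∘ f) = 0` for all covectors `φ, ψ`.
[cite: vanGeemen1994HodgeAV, Lemma 5.2 (1)] -/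
theorem altDual_two_derivation (φ ψ : Module.Dual F V) (f : V →ₗ[F] V) (ω : ⋀[F]^2 V)
    (h : exteriorPower.map 2 (LinearMap.id + f) ω = ω + exteriorPower.map 2 f ω) :
    exteriorPower.alternatingMapToDual F V 2 ![φ ∘ₗ f, ψ] ω +
      exteriorPower.alternatingMapToDual F V 2 ![φ, ψ ∘ₗ f] ω = 0 := by
  -- the expansion `B(φ(1+f), ψ(1+f)) - B(φ, ψ) - B(φf, ψf) = B(φf, ψ) + B(φ, ψf)` as functionals of `ω`
  have key : exteriorPower.alternatingMapToDual F V 2 ![φ ∘ₗ (LinearMap.id + f), ψ ∘ₗ (LinearMap.id + f)] -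
      exteriorPower.alternatingMapToDual F V 2 ![φ, ψ] -
      exteriorPower.alternatingMapToDual F V 2 ![φ ∘ₗ f, ψ ∘ₗ f] =
      exteriorPower.alternatingMapToDual F V 2 ![φ ∘ₗ f, ψ] +
        exteriorPower.alternatingMapToDual F V 2 ![φ, ψ ∘ₗ f] := by
    refine dual_exteriorPower_two_ext fun v ↦ ?_
    simp only [LinearMap.sub_apply, LinearMap.add_apply, altDual_two_ιMulti, LinearMap.coe_comp,
      Function.comp_apply, LinearMap.id_coe, id_eq, map_add]
    ring
  have e1 := altDual_two_map φ ψ (LinearMap.id + f) ω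
  rw [h, map_add, altDual_two_map φ ψ f ω] at e1
  have h1 := LinearMap.congr_fun key ω
  simp only [LinearMap.sub_apply, LinearMap.add_apply] at h1
  rw [← e1] at h1
  rw [← h1]
  ring

end Wedge

/-! ### §3 From the derivation identity on imaginary integers to the dual-form Rosati identity on all of `K` -/

section Assembly

variable {K : Type*} [Field K] [NumberField K] [IsCMField K]
variable {V : Type*} [AddCommGroup V] [Module ℚ V]

/-- **Dual-form Rosati from the derivation identity (abstract action).**  For a `ℚ`-algebra action
`ι : K → End_ℚ V` of a CM field and `ω ∈ ⋀²V`: if `B_ω(φ ∘ ι b, ψ) + B_ω(φ, ψ ∘ ι b) = 0` for every purely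
imaginary ALGEBRAIC INTEGER `b ∈ 𝓞_K`, then `B_ω(φ ∘ ι a, ψ) = B_ω(φ, ψ ∘ ι ā)` for EVERY `a ∈ K` (the set of such
`a` is stable under `+` and `*` and contains the imaginary elements, `m • b ∈ 𝓞_K`; §1).
[cite: Deligne1982HodgeCycles, §4 p. 47] [cite: Shimura1998, §6.2 Thm. 4] -/
theorem altDual_rosati_of_balanced (ι : K →ₐ[ℚ] Module.End ℚ V) (ω : ⋀[ℚ]^2 V)
    (h : ∀ b : 𝓞 K, IsCMField.complexConj K b = -(b : K) →
      ∀ φ ψ : Module.Dual ℚ V,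
        exteriorPower.alternatingMapToDual ℚ V 2 ![φ ∘ₗ ι b, ψ] ω +
          exteriorPower.alternatingMapToDual ℚ V 2 ![φ, ψ ∘ₗ ι b] ω = 0)
    (a : K) (φ ψ : Module.Dual ℚ V) :
    exteriorPower.alternatingMapToDual ℚ V 2 ![φ ∘ₗ ι a, ψ] ω =
      exteriorPower.alternatingMapToDual ℚ V 2 ![φ, ψ ∘ₗ ι (IsCMField.complexConj K a)] ω := by
  revert φ ψ
  refine IsCMField.forall_of_forall_imaginary (K := K)
    (P := fun a ↦ ∀ φ ψ : Module.Dual ℚ V,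
      exteriorPower.alternatingMapToDual ℚ V 2 ![φ ∘ₗ ι a, ψ] ω =
        exteriorPower.alternatingMapToDual ℚ V 2 ![φ, ψ ∘ₗ ι (IsCMField.complexConj K a)] ω) ?_ ?_ ?_ a
  · -- additivity
    intro a b ha hb φ ψ
    rw [map_add, LinearMap.comp_add, altDual_two_add_left, ha, hb, map_add, map_add, LinearMap.comp_add,
      altDual_two_add_right]
  · -- multiplicativity
    intro a b ha hb φ ψ
    rw [map_mul, Module.End.mul_eq_comp, ← LinearMap.comp_assoc, hb, ha, LinearMap.comp_assoc,
      ← Module.End.mul_eq_comp, ← map_mul ι, ← map_mul (IsCMField.complexConj K), mul_comm b a]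
  · -- imaginary elements: reduce to an imaginary integer `s = m • b`
    intro b hb φ ψ
    obtain ⟨m, s, hm, hs, hsconj⟩ := IsCMField.exists_nsmul_mem_ringOfIntegers_imaginary b hb
    have h0 := h s hsconj φ ψ
    have hιs : ι (s : K) = (m : ℚ) • ι b := by rw [← hs, map_smul]
    rw [hιs, LinearMap.comp_smul, LinearMap.comp_smul, altDual_two_smul_left, altDual_two_smul_right,
      ← mul_add, mul_eq_zero] at h0
    have hb' : exteriorPower.alternatingMapToDual ℚ V 2 ![φ ∘ₗ ι b, ψ] ω +
        exteriorPower.alternatingMapToDual ℚ V 2 ![φ, ψ ∘ₗ ι b] ω = 0 :=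
      h0.resolve_left (Nat.cast_ne_zero.2 hm)
    rw [hb, map_neg, LinearMap.comp_neg, altDual_two_neg_right]
    exact eq_neg_of_add_eq_zero_left hb'

end Assembly

/-! ### §4 Betti specialisation: `K`-balanced on `H²(A(ℂ); ℚ)` along morphisms ⟹ dual-form Rosati -/

section Betti

variable {K : Type} [Field K] [NumberField K] [IsCMField K]
variable (A : AbelianVariety ℂ)

/-- **Naturality of the rational comparison isomorphism `⋀² H¹ ≅ H²` under pull-back** along a `ℂ`-morphism
`f : A → A`: `(wedgeToCup)⁻¹ (f^* θ) = ⋀²(f^*|_{H¹}) ((wedgeToCup)⁻¹ θ)`. [cite: LangeBirkenhake1992, Lemma 1.1.17] -/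
theorem ratWedge_symm_pull (f : A.X ⟶ A.X) (θ : bettiCohomology A.X 2) :
    ((hasExteriorCohomologyH1_rat A).equiv 2).symm (BettiUniverse.pull f 2 θ) =
      exteriorPower.map 2 (BettiUniverse.pull f 1) (((hasExteriorCohomologyH1_rat A).equiv 2).symm θ) := by
  apply ((hasExteriorCohomologyH1_rat A).equiv 2).injective
  rw [LinearEquiv.apply_symm_apply, HasExteriorCohomologyH1.equiv_apply]
  conv_lhs => rw [← ((hasExteriorCohomologyH1_rat A).equiv 2).apply_symm_apply θ,
    HasExteriorCohomologyH1.equiv_apply]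
  exact map_wedgeToCup (AlgPoints.mapContinuous (L := ℂ) f) 2 _

/-- **Dual-form Rosati from the `K`-balanced identity on `H²` (Betti carriers).**  Let `A/ℂ` be an abelian variety,
`ι : K → End_ℚ H¹(A(ℂ); ℚ)` a `ℚ`-algebra action of a CM field, `θ ∈ H²(A(ℂ); ℚ)` and `ω = (wedgeToCup)⁻¹ θ ∈
⋀² H¹(A(ℂ); ℚ)`.  Suppose that for every purely imaginary `b ∈ 𝓞_K` there are `ℂ`-morphisms `F, G : A → A` with
`F^* = ι(b)` and `G^* = 1 + F^*` on `H¹` (in practice `F = u(b)`, `G = 𝟙 + u(b)` for an action `u` by endomorphisms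
of the abelian variety) such that `G^* θ = θ + F^* θ` on `H²` (the `K`-BALANCED identity).  Then
`B_θ(φ ∘ ι a, ψ) = B_θ(φ, ψ ∘ ι ā)` for all `a ∈ K` and all covectors `φ, ψ` — the Rosati involution of `θ`
induces complex conjugation on `K`, in the dual Betti form.
[cite: Deligne1982HodgeCycles, §4 p. 47 and §5 Prop. 5.1] [cite: Shimura1998, §6.2 Thm. 4]
[cite: vanGeemen1994HodgeAV, Lemma 5.2 (1)] -/
theorem bettiDual_rosati_of_balanced (ι : K →ₐ[ℚ] Module.End ℚ (bettiCohomology A.X 1))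
    (θ : bettiCohomology A.X 2)
    (hbal : ∀ b : 𝓞 K, IsCMField.complexConj K b = -(b : K) →
      ∃ F G : A.X ⟶ A.X, BettiUniverse.pull F 1 = ι (b : K) ∧
        BettiUniverse.pull G 1 = LinearMap.id + BettiUniverse.pull F 1 ∧
        BettiUniverse.pull G 2 θ = θ + BettiUniverse.pull F 2 θ)
    (a : K) (φ ψ : Module.Dual ℚ (bettiCohomology A.X 1)) :
    exteriorPower.alternatingMapToDual ℚ (bettiCohomology A.X 1) 2 ![φ ∘ₗ ι a, ψ]
        (((hasExteriorCohomologyH1_rat A).equiv 2).symm θ) =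
      exteriorPower.alternatingMapToDual ℚ (bettiCohomology A.X 1) 2
        ![φ, ψ ∘ₗ ι (IsCMField.complexConj K a)] (((hasExteriorCohomologyH1_rat A).equiv 2).symm θ) := by
  refine altDual_rosati_of_balanced ι _ (fun b hb φ ψ ↦ ?_) a φ ψ
  obtain ⟨F, G, hF, hG, hθ⟩ := hbal b hb
  refine altDual_two_derivation φ ψ (ι (b : K)) _ ?_
  have h := congrArg ((hasExteriorCohomologyH1_rat A).equiv 2).symm hθ
  rw [map_add, ratWedge_symm_pull, ratWedge_symm_pull, hG, hF] at h
  exact h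

/-- **Endomorphisms of an abelian variety act additively on rational `H¹`**: `(f + g)^* = f^* + g^*` on
`H¹(B(ℂ); ℚ)` for homomorphisms `f, g : A → B` of complex abelian varieties (the tree's `complexBetti_map_add_one`
over `ℂ`, descended along the injective rational lattice `H¹(–; ℚ) ↪ H¹(–; ℂ)`).
[cite: LangeBirkenhake1992, §1.1 (p. 19)] -/
theorem pull_add_one {A B : AbelianVariety ℂ} (f g : A ⟶ B) :
    BettiUniverse.pull (f + g).hom.hom.hom 1 =
      BettiUniverse.pull f.hom.hom.hom 1 + BettiUniverse.pull g.hom.hom.hom 1 := by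
  refine LinearMap.ext fun v ↦ ofRatClass_injective (Y := ComplexPoints A.X) 1 ?_
  rw [LinearMap.add_apply, map_add]
  change ofRatClass _ 1 (bettiCohomology.map (f + g).hom.hom.hom 1 v) =
    ofRatClass _ 1 (bettiCohomology.map f.hom.hom.hom 1 v) + ofRatClass _ 1 (bettiCohomology.map g.hom.hom.hom 1 v)
  rw [Motives.ofRatClass_map, Motives.ofRatClass_map, Motives.ofRatClass_map]
  change complexBetti.map (f + g).hom.hom.hom 1 _ = complexBetti.map f.hom.hom.hom 1 _ +
    complexBetti.map g.hom.hom.hom 1 _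
  rw [complexBetti_map_add_one]
  rfl

/-- **Dual-form Rosati for an action by endomorphisms of the abelian variety.**  Let `u : 𝓞_K → End(A)` be any
map (in practice a ring homomorphism) such that `u(b)^* = ι(b)` on `H¹(A(ℂ); ℚ)` for the `ℚ`-algebra action `ι`
of the CM field `K`, and suppose the `K`-BALANCED identity `(𝟙 + u b)^* θ = θ + (u b)^* θ` on `H²(A(ℂ); ℚ)` for
every purely imaginary `b ∈ 𝓞_K`.  Then `B_θ(φ ∘ ι a, ψ) = B_θ(φ, ψ ∘ ι ā)` for every `a ∈ K`.
[cite: Deligne1982HodgeCycles, §4 p. 47 and §5 Prop. 5.1] [cite: Shimura1998, §6.2 Thm. 4]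
[cite: vanGeemen1994HodgeAV, Lemma 5.2 (1)] -/
theorem bettiDual_rosati_of_balanced_endo (ι : K →ₐ[ℚ] Module.End ℚ (bettiCohomology A.X 1))
    (u : 𝓞 K → (A ⟶ A)) (hu : ∀ b : 𝓞 K, BettiUniverse.pull (u b).hom.hom.hom 1 = ι (b : K))
    (θ : bettiCohomology A.X 2)
    (hbal : ∀ b : 𝓞 K, IsCMField.complexConj K b = -(b : K) →
      BettiUniverse.pull (𝟙 A + u b).hom.hom.hom 2 θ = θ + BettiUniverse.pull (u b).hom.hom.hom 2 θ)
    (a : K) (φ ψ : Module.Dual ℚ (bettiCohomology A.X 1)) :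
    exteriorPower.alternatingMapToDual ℚ (bettiCohomology A.X 1) 2 ![φ ∘ₗ ι a, ψ]
        (((hasExteriorCohomologyH1_rat A).equiv 2).symm θ) =
      exteriorPower.alternatingMapToDual ℚ (bettiCohomology A.X 1) 2
        ![φ, ψ ∘ₗ ι (IsCMField.complexConj K a)] (((hasExteriorCohomologyH1_rat A).equiv 2).symm θ) := by
  refine bettiDual_rosati_of_balanced A ι θ (fun b hb ↦ ?_) a φ ψ
  refine ⟨(u b).hom.hom.hom, (𝟙 A + u b).hom.hom.hom, hu b, ?_, hbal b hb⟩
  rw [pull_add_one]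
  congr 1
  change BettiUniverse.pull (𝟙 A.X) 1 = LinearMap.id
  exact BettiUniverse.pull_id A.X 1

end Betti

end Summit.HodgeConjecture.CorCM.Model

end
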